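import Summits.BirchSwinnertonDyer.BirchSwinnertonDyer.Theorems.AdditiveKolyvaginRoadChebTarget
import Summits.BirchSwinnertonDyer.BirchSwinnertonDyer.Theorems.ClassRecordThreeShimuraKolyvaginImageInputs
import HarnessLib

/-!
# Line `admdef`, cell β (`p ∤ N_E` good supersingular, `p` SPLIT in `K`): the ADMISSIBLE TARGET of the
# Čebotarev argument at a general prime `p ≥ 5`, at ANY frame carrying a ramified prime of `K` away from `p N_E`
# (crux `AnticyclotomicEisensteinDivisibility`, stmt-BirchSwinnertonDyer-20727; LEAD seat bsd-line-sbc-p1 gen 17,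
# `--supports stmt-BirchSwinnertonDyer-20727`)

WHY THIS FILE.  The v6 research stubs `stub_definiteNV_twoMult/leOneMult` ([NV″]) of the line of record
`Cruxes/AnticyclotomicEisensteinDivisibility/Lines/admdef.lean` ask for an ODD Zhang-admissible level with a non-zero mod-`p`
toric period.  The ideator's crux idea «selwalk» (bsd-idea-5 g22, `Ideas/selwalk.md`, `Lines/selwalk_sketch.lean`) reads
the (P2) half of [NV″] — W. Zhang's Selmer-killing walk to an odd zero vertex — off the sibling cell `AdditiveKolyvaginRoad`,
whose kernel engine (`AdditiveKoly.selQP_rankLowering_of_localGlobal`, `…exists_zero_vertex_above`) takes ONE frame-dependent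
input: (Cheb) = Čebotarev with the sign at Bertolini–Darmon admissible primes (`AdditiveKoly.Cheb.exists_admissible_loc_ne_zero`,
W. Zhang 2014 Lemma 7.3 ∕ Bertolini–Darmon 2005 Thm 3.2), PROVED there under `p ∣ N_E`.  That hypothesis is used exactly once,
in `AdditiveKoly.Cheb.exists_prime_dvd_discr_not_dvd` (a prime `q₀ ∣ d_K` with `q₀ ∤ p N_E`, Gross's disjointness prime),
consumed by `AdditiveKoly.Cheb.exists_admissible_target`.  THIS FILE generalises that target theorem to ANY frame on which such
a ramified prime is GIVEN (`exists_admissible_target_of_ramifiedPrime` — the AKR proof verbatim with the prime as a hypothesis),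
and supplies the prime on cell β from «`p` split in `K`» (`exists_prime_dvd_discr_not_dvd_of_split`, the selwalk sketch's §1,
credited).  The sequel `…AdmdefChebSplit.lean` does the same for the Čebotarev theorem itself.

WHAT IS PROVED (kernel; no definition, no named fact, no `sorry`):
* `exists_prime_dvd_discr_not_dvd_of_split` — `K` imaginary quadratic, `N_E` Heegner in `K`, `p` split ⟹ ∃ prime `q ∣ d_K`,
  `q ∤ N_E`, `q ∤ p` (split primes are unramified; tree `ShimuraKolyvaginImageInputs.exists_prime_dvd_discr_not_dvd`).
* `exists_admissible_target_of_ramifiedPrime` — on the frame (`K` imaginary quadratic, `ρ̄_{E,p}` onto, `p ≥ 5`, a prime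
  `q₀ ∣ d_K` with `q₀ ∤ N_E`, `q₀ ∤ p`), for the involutive lift `t` of complex conjugation and a sign `ν = ±1`: `g₁ ∈ Γ_K` and an
  additive frame `e : E(K̄)[p] ≃ 𝔽_p²` with `e (T (g₁ Q)) = D (e Q)`, `D = diag(ν, 2ν)`, and `c₀ · res g₁` acting on `E(ℚ̄)[p]` as `D`.
* `exists_admissible_target_of_split` — the cell-β instance (`N_E` Heegner, `p` split).

HONEST FRAMING: a port (generalisation of one hypothesis) of the AKR cell's theorem (lead `bsd-wall-akr-p1` g2, itself a port of
koly g13's `exists_unipotent_target`); nothing about Heegner points, [NV″] or the crux is asserted.  BSD is not proved by this file.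

References: [cite: WZhang2014, Lemma 7.3] [cite: BertoliniDarmon2005, Thm. 3.2] [cite: GrossLMS1991, §9 (PDF p. 227), Prop. 9.1, 9.3].
-/

-- D-0017: single-problem summit, the namespace repeats the problem name by design.
set_option linter.dupNamespace false
set_option autoImplicit false

noncomputable section

open scoped Classical Pointwise

namespace Summit.BirchSwinnertonDyer.BirchSwinnertonDyer.Theorems.SignedBaseChangeAcDivAdmdefChebSplit

open WeierstrassCurve Field Function NumberField IsDedekindDomain Rat.HeightOneSpectrum
open Literature.NumberTheory.EllipticCurves Literature.NumberTheory.GaloisRepresentations Module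
open Summit.BirchSwinnertonDyer.BirchSwinnertonDyer.Theorems
open Summit.BirchSwinnertonDyer.Rank1Residual.X11b.Three.Koly.Method2

variable (W : WeierstrassCurve ℚ) (K : Type) [Field K] [NumberField K] [W.IsElliptic]

/-! ## §1 Gross's disjointness prime from «`p` split in `K`» (the selwalk dictionary entry) -/

omit [W.IsElliptic] in
/-- **A ramified prime away from `p N_E`, from `p` SPLIT** (the statement of
`AdditiveKoly.Cheb.exists_prime_dvd_discr_not_dvd` with its hypothesis `p ∣ N_E` replaced by the cell-β binder «`p` splits in `K`»):
for `K` imaginary quadratic, `N_E` Heegner in `K` and `p` split, some prime `q ∣ d_K` divides neither `N_E` nor `p` (split primes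
are unramified).  Proof = crux-idea selwalk §1 (bsd-idea-5 g22), from `ShimuraKolyvaginImageInputs.exists_prime_dvd_discr_not_dvd`
with `N := p·N_E`, `S := ∅`.  [cite: GrossLMS1991, §9 (PDF p. 227)] -/
theorem exists_prime_dvd_discr_not_dvd_of_split (hK : IsImaginaryQuadratic K) {p : ℕ} (hp : p.Prime)
    (hsp : ((Ideal.span {(p : ℤ)}).primesOver (𝓞 K)).ncard = 2) (hH : SatisfiesHeegnerHypothesis (W.conductorNorm ℤ) K) :
    ∃ q : ℕ, q.Prime ∧ (q : ℤ) ∣ NumberField.discr K ∧ ¬ q ∣ W.conductorNorm ℤ ∧ ¬ (q : ℤ) ∣ ((p : ℕ) : ℤ) := by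
  obtain ⟨q, hq, hqd, hqN⟩ := ShimuraKolyvaginImageInputs.exists_prime_dvd_discr_not_dvd K hK.1 (N := p * W.conductorNorm ℤ) ∅
    (fun _ h ↦ absurd h (Finset.notMem_empty _))
    (fun ℓ hℓ hℓN _ ↦ by
      rcases (Nat.Prime.dvd_mul hℓ).mp hℓN with h | h
      · obtain rfl : ℓ = p := (Nat.prime_dvd_prime_iff_eq hℓ hp).mp h
        exact hsp
      · exact hH ℓ hℓ h)
  refine ⟨q, hq, hqd, fun h ↦ hqN (Dvd.dvd.mul_left h p), fun h ↦ hqN ?_⟩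
  have h' : q ∣ p := by exact_mod_cast h
  exact Dvd.dvd.mul_right h' _

/-! ## §2 The admissible target at a frame with a GIVEN ramified prime away from `p N_E` -/

section Target

variable [W.IsGloballyMinimal]

/-- `2 ≠ 0` in `𝔽_p` for `p ≥ 5` (copy of the AKR private lemma). [folklore] -/
private theorem two_ne_zero_zmod' {p : ℕ} [Fact p.Prime] (h5 : 5 ≤ p) : (2 : ZMod p) ≠ 0 := by
  intro h
  have : (p : ℕ) ∣ 2 := by
    have h' : ((2 : ℕ) : ZMod p) = 0 := by exact_mod_cast h
    exact (ZMod.natCast_eq_zero_iff 2 p).mp h'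
  have := Nat.le_of_dvd (by norm_num) this
  omega

omit [W.IsGloballyMinimal] in
/-- **The admissible target of the Čebotarev argument, at ANY frame with a ramified prime away from `p N_E`.**  On the frame
(`K` imaginary quadratic, `ρ̄_{E,p}` onto, `p ≥ 5`, a prime `q₀ ∣ d_K` with `q₀ ∤ N_E` and `q₀ ∤ p`), for the lift `t = e c₀ e⁻¹` of the
complex conjugation `c` of `K` (`IsLiftOfAut c t`, `t² = 1`) and a sign `ν = ±1`, there are `g₁ ∈ Γ_K` and an additive frame
`e : E(K̄)[p] ≃ 𝔽_p²` with `e (T (g₁ Q)) = D (e Q)` for all `Q`, `D(v₀, v₁) = (ν v₀, 2ν v₁)` (`T` the involution of `E(K̄)[p]` induced by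
`t`), and `c₀ · res(g₁)` acting on `E(ℚ̄)[p]`, read in `E(K̄)[p]` through `RatClosure.torsionEquiv`, as `D`.  This is
`AdditiveKoly.Cheb.exists_admissible_target` (AKR lead g2; port of koly g13's `exists_unipotent_target`) with its hypotheses
`p ∣ N_E` + Heegner — used there ONLY to produce `q₀` — replaced by `q₀` itself; the proof is otherwise verbatim: the automorphism
`θ⁻¹ T (e⁻¹ D e) θ` of `E(ℚ̄)[p]` is `ρ̄(γ_M)` for some `γ_M ∈ Γ_ℚ` (surjectivity), and `γ_M` acts on `E[p]` as some `res g₁`, `g₁ ∈ Γ_K`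
(Gross's disjointness at `q₀`, `ShimuraKolyvaginImageDisjoint.exists_absGaloisRestrict_smul_eq`).
[cite: GrossLMS1991, §9 (PDF p. 227)] [cite: WZhang2014, Lemma 7.3 (proof)] [cite: BertoliniDarmon2005, Thm. 3.2] -/
theorem exists_admissible_target_of_ramifiedPrime {p : ℕ} [Fact p.Prime] (h5 : 5 ≤ p) (hK : IsImaginaryQuadratic K)
    (hsurj : W.HasSurjectiveModNGaloisRep p)
    {q₀ : ℕ} (hq₀ : q₀.Prime) (hq₀d : (q₀ : ℤ) ∣ NumberField.discr K) (hq₀N : ¬ q₀ ∣ W.conductorNorm ℤ)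
    (hq₀p : ¬ (q₀ : ℤ) ∣ ((p : ℕ) : ℤ))
    {c : K ≃ₐ[ℚ] K} {c₀ : absoluteGaloisGroup ℚ}
    (ht : IsLiftOfAut c (absGaloisTransport (K := ℚ) (L := K) c₀).toRingEquiv)
    (hinv : ∀ x, (absGaloisTransport (K := ℚ) (L := K) c₀).toRingEquiv
      ((absGaloisTransport (K := ℚ) (L := K) c₀).toRingEquiv x) = x)
    {ν : ℤ} (hν : ν = 1 ∨ ν = -1) :
    ∃ (g₁ : absoluteGaloisGroup K) (e : geomTorsion (W.baseChange K) (p : ℤ) ≃+ (Fin 2 → ZMod p)),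
      (∀ Q, e (ht.torsionMap W (p : ℤ) (g₁ • Q)) = ![(ν : ZMod p) * e Q 0, (ν : ZMod p) * 2 * e Q 1]) ∧
      (∀ P : geomTorsion W (p : ℤ),
        e (RatClosure.torsionEquiv (K := K) W (p : ℤ) ((c₀ * absGaloisRestrict ℚ K g₁) • P)) =
          ![(ν : ZMod p) * e (RatClosure.torsionEquiv (K := K) W (p : ℤ) P) 0,
            (ν : ZMod p) * 2 * e (RatClosure.torsionEquiv (K := K) W (p : ℤ) P) 1]) := by
  -- adapted from Theorems/AdditiveKolyvaginRoadChebTarget.lean `exists_admissible_target` (l.157–242), `q₀` now a hypothesis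
  have hp : p.Prime := Fact.out
  set n : ℤ := (p : ℤ) with hn
  have hνν : ν * ν = 1 := by rcases hν with rfl | rfl <;> norm_num
  have hννk : (ν : ZMod p) * (ν : ZMod p) = 1 := by rw [← Int.cast_mul, hνν, Int.cast_one]
  have h2 : (2 : ZMod p) ≠ 0 := two_ne_zero_zmod' h5
  -- ### `E(K̄)[p] ≃ (ℤ/p)²`
  have hTp : ∀ P : geomTorsion (W.baseChange K) n, p • P = 0 := fun P ↦ by
    have := (mem_geomTorsion_iff (W.baseChange K) n _).mp P.2
    apply Subtype.ext
    rw [AddSubgroupClass.coe_nsmul, ← natCast_zsmul]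
    exact this
  have hcard : Nat.card (geomTorsion (W.baseChange K) n) = p ^ 2 :=
    card_torsionPoints_eq_sq_holds (W.baseChange K) (AlgebraicClosure K) (n := p) (by exact_mod_cast hp.ne_zero)
  obtain ⟨eT⟩ := KolyvaginImage.nonempty_addEquiv_of_card_eq_sq (p := p) hTp hcard
  -- ### `D = diag(ν, 2ν)` as an additive automorphism of `𝔽_p²`
  set D : (Fin 2 → ZMod p) ≃+ (Fin 2 → ZMod p) :=
    { toFun := fun v ↦ ![(ν : ZMod p) * v 0, (ν : ZMod p) * 2 * v 1]
      invFun := fun v ↦ ![(ν : ZMod p) * v 0, (ν : ZMod p) * 2⁻¹ * v 1]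
      left_inv := fun v ↦ by
        ext i
        fin_cases i
        · simp only [Fin.zero_eta, Fin.isValue, Matrix.cons_val_zero]
          rw [← mul_assoc, hννk, one_mul]
        · simp only [Fin.mk_one, Fin.isValue, Matrix.cons_val_one, Matrix.cons_val_zero]
          have : (ν : ZMod p) * 2⁻¹ * ((ν : ZMod p) * 2 * v 1) =
              ((ν : ZMod p) * (ν : ZMod p)) * (2⁻¹ * 2) * v 1 := by ring
          rw [this, hννk, inv_mul_cancel₀ h2, one_mul, one_mul]
      right_inv := fun v ↦ by
        ext i
        fin_cases i
        · simp only [Fin.zero_eta, Fin.isValue, Matrix.cons_val_zero]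
          rw [← mul_assoc, hννk, one_mul]
        · simp only [Fin.mk_one, Fin.isValue, Matrix.cons_val_one, Matrix.cons_val_zero]
          have : (ν : ZMod p) * 2 * ((ν : ZMod p) * 2⁻¹ * v 1) =
              ((ν : ZMod p) * (ν : ZMod p)) * (2 * 2⁻¹) * v 1 := by ring
          rw [this, hννk, mul_inv_cancel₀ h2, one_mul, one_mul]
      map_add' := fun a b ↦ by
        ext i
        fin_cases i
        · simp only [Fin.zero_eta, Fin.isValue, Matrix.cons_val_zero, Pi.add_apply]; ring
        · simp only [Fin.mk_one, Fin.isValue, Matrix.cons_val_one, Matrix.cons_val_zero, Pi.add_apply]; ring }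
    with hD
  have hDapply : ∀ v, D v = ![(ν : ZMod p) * v 0, (ν : ZMod p) * 2 * v 1] := fun v ↦ rfl
  -- `A = e⁻¹ D e` on `E(K̄)[p]`
  set A : geomTorsion (W.baseChange K) n ≃+ geomTorsion (W.baseChange K) n := eT.trans (D.trans eT.symm) with hA
  have hAapply : ∀ Q, eT (A Q) = D (eT Q) := fun Q ↦ by
    rw [hA, AddEquiv.trans_apply, AddEquiv.trans_apply, AddEquiv.apply_symm_apply]
  -- ### the involution `T` of `E(K̄)[p]` induced by the lift of `c`, as an additive equivalence
  have hTT : ∀ Q, ht.torsionMap W n (ht.torsionMap W n Q) = Q := ht.torsionMap_torsionMap W hinv n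
  set Teq : geomTorsion (W.baseChange K) n ≃+ geomTorsion (W.baseChange K) n :=
    { toFun := ht.torsionMap W n, invFun := ht.torsionMap W n, left_inv := hTT, right_inv := hTT,
      map_add' := fun a b ↦ map_add _ a b }
    with hTeq
  -- ### `γ_M ∈ Γ_ℚ` acting on `E(ℚ̄)[p]` as `θ⁻¹ T A θ` (surjectivity of `ρ̄_{E,p}`)
  set θ := RatClosure.torsionEquiv (K := K) W n with hθ
  set A₀ : geomTorsion W n ≃+ geomTorsion W n := θ.trans ((A.trans Teq).trans θ.symm) with hA₀
  have hA₀apply : ∀ P, A₀ P = θ.symm (ht.torsionMap W n (A (θ P))) := fun P ↦ rfl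
  have hsurj' : Function.Surjective (galoisRepTorsion W n) := hsurj
  obtain ⟨γM, hγM⟩ := hsurj' (Multiplicative.ofAdd A₀)
  have hγM' : ∀ P : geomTorsion W n, γM • P = A₀ P := fun P ↦ by
    rw [← galoisRepTorsion_apply, hγM]; rfl
  -- ### `g₁ ∈ Γ_K` acting on `E(ℚ̄)[p]` as `γ_M` (Gross's disjointness at the GIVEN ramified prime `q₀`)
  obtain ⟨g₁, hg₁⟩ :=
    ShimuraKolyvaginImageDisjoint.exists_absGaloisRestrict_smul_eq W K hK.1 hq₀ hq₀d hq₀N hq₀p γM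
  have hG : ∀ Q, ht.torsionMap W n (g₁ • Q) = A Q := fun Q ↦ by
    obtain ⟨P, rfl⟩ := θ.surjective Q
    rw [← RatClosure.torsionEquiv_smul, hg₁, hγM', hA₀apply, ← hθ, θ.apply_symm_apply, hTT]
  refine ⟨g₁, eT, fun Q ↦ ?_, fun P ↦ ?_⟩
  · rw [hG, hAapply, hDapply]
  · rw [mul_smul, RatClosure.torsionEquiv_smul_of_lift W ht c₀ (fun _ ↦ rfl) n, ← hθ, RatClosure.torsionEquiv_smul,
      hG, hAapply, hDapply]

omit [W.IsGloballyMinimal] in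
/-- **The admissible target on cell β** (`K` imaginary quadratic, `ρ̄_{E,p}` onto, `p ≥ 5`, `N_E` Heegner in `K`, `p` SPLIT in `K`):
`exists_admissible_target_of_ramifiedPrime` fed with the disjointness prime of `exists_prime_dvd_discr_not_dvd_of_split`.
[cite: WZhang2014, Lemma 7.3 (proof)] [cite: BertoliniDarmon2005, Thm. 3.2] -/
theorem exists_admissible_target_of_split {p : ℕ} [Fact p.Prime] (h5 : 5 ≤ p) (hK : IsImaginaryQuadratic K)
    (hsurj : W.HasSurjectiveModNGaloisRep p)
    (hsp : ((Ideal.span {(p : ℤ)}).primesOver (𝓞 K)).ncard = 2) (hH : SatisfiesHeegnerHypothesis (W.conductorNorm ℤ) K)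
    {c : K ≃ₐ[ℚ] K} {c₀ : absoluteGaloisGroup ℚ}
    (ht : IsLiftOfAut c (absGaloisTransport (K := ℚ) (L := K) c₀).toRingEquiv)
    (hinv : ∀ x, (absGaloisTransport (K := ℚ) (L := K) c₀).toRingEquiv
      ((absGaloisTransport (K := ℚ) (L := K) c₀).toRingEquiv x) = x)
    {ν : ℤ} (hν : ν = 1 ∨ ν = -1) :
    ∃ (g₁ : absoluteGaloisGroup K) (e : geomTorsion (W.baseChange K) (p : ℤ) ≃+ (Fin 2 → ZMod p)),
      (∀ Q, e (ht.torsionMap W (p : ℤ) (g₁ • Q)) = ![(ν : ZMod p) * e Q 0, (ν : ZMod p) * 2 * e Q 1]) ∧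
      (∀ P : geomTorsion W (p : ℤ),
        e (RatClosure.torsionEquiv (K := K) W (p : ℤ) ((c₀ * absGaloisRestrict ℚ K g₁) • P)) =
          ![(ν : ZMod p) * e (RatClosure.torsionEquiv (K := K) W (p : ℤ) P) 0,
            (ν : ZMod p) * 2 * e (RatClosure.torsionEquiv (K := K) W (p : ℤ) P) 1]) := by
  obtain ⟨q₀, hq₀, hq₀d, hq₀N, hq₀p⟩ := exists_prime_dvd_discr_not_dvd_of_split W K hK (Fact.out) hsp hH
  exact exists_admissible_target_of_ramifiedPrime W K h5 hK hsurj hq₀ hq₀d hq₀N hq₀p ht hinv hν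

end Target

end Summit.BirchSwinnertonDyer.BirchSwinnertonDyer.Theorems.SignedBaseChangeAcDivAdmdefChebSplit

end
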